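import Literature.Geometry.Riemannian.ShrinkerLocalisedMaximumPrinciple
import HarnessLib

/-!
# Helper `helper_mwShrinkerMaxPrinciple` of line `collapsed-ends-usc` (crux
# `EntropyRung.NoncompactShrinkerGap`, stmt-SmoothPoincare4-10868): the localised maximum principle
# on a complete gradient shrinker

Registered helper stub S9 of the Munteanu–Wang 2015, Thm. 1.4 programme (bounded `S` forces bounded
`|Ric|`, `|Rm|` on complete four-dimensional gradient shrinkers; brick 1 of route item 16588): the
Omori–Yau substitute used twice in that proof. On a connected Riemannian manifold modelled on `ℝⁿ`
carrying a normalised gradient shrinker `Ric + Hess f = ½ g`, `S + |∇f|² = f`, `S ≥ 0`, with compact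
sub-level sets `{f ≤ c}`, every smooth `u` with `Δu − ⟨∇f, ∇u⟩ ≥ α u² − β` on `{f ≥ r₀}` (`α > 0`)
is bounded above. This is the specialisation to the model `𝓡 n` of the Literature theorem
`Literature.Geometry.Riemannian.Shrinker.bounded_of_drift_laplacian_ge_sq`
(`Literature/Geometry/Riemannian/ShrinkerLocalisedMaximumPrinciple.lean`, the argument of
Munteanu–Wang 2015, proof of Prop. 1.3, with the cut-offs `Θ_A(f)` of Zhang 2009).
Everything is proved; no definitions.
-/

noncomputable section

-- `Summit.SmoothPoincare4.SmoothPoincare4.…` (summit = problem) trips `dupNamespace` on every decl.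
set_option linter.dupNamespace false

open scoped Manifold ContDiff Topology NNReal ENNReal
open Set Filter Module
open Literature.Geometry.Lorentzian Literature.Geometry.Riemannian

namespace Summit.SmoothPoincare4.SmoothPoincare4.Theorems.NoncompactShrinkerGapMW

/-- Registered helper `helper_mwShrinkerMaxPrinciple` (stub S9): the localised maximum principle on a
normalised gradient shrinker with proper potential — `Δ_f u ≥ α u² − β` on `{f ≥ r₀}` with `α > 0`
forces `u` bounded above (`Shrinker.bounded_of_drift_laplacian_ge_sq` at the model `𝓡 n`).
[cite: MunteanuWang2015, Prop. 1.3 (proof)] -/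
theorem helper_mwShrinkerMaxPrinciple : ∀ (n : ℕ) (M : Type) [TopologicalSpace M] [T2Space M] [SecondCountableTopology M] [ChartedSpace (EuclideanSpace ℝ (Fin n)) M] [IsManifold (𝓡 n) ∞ M] [ConnectedSpace M] [T3Space M] (g : PseudoRiemannianMetric (𝓡 n) ∞ (EuclideanSpace ℝ (Fin n)) (TangentSpace (𝓡 n) : M → Type _)) [g.HasLeviCivita] (f u : M → ℝ) (hg : g.IsRiemannian) (α β r₀ : ℝ), 0 < α → (∀ c : ℝ, IsCompact {y : M | f y ≤ c}) → ContMDiff (𝓡 n) 𝓘(ℝ, ℝ) ∞ f → ContMDiff (𝓡 n) 𝓘(ℝ, ℝ) ∞ u → (∀ (x : M) (X Y : TangentSpace (𝓡 n) x), g.ricci x X Y + g.hessian f x X Y = (1 / 2 : ℝ) * g.val x X Y) → (∀ x : M, g.scalarCurvature x + g.gradSq f x = f x) → (∀ x : M, 0 ≤ g.scalarCurvature x) → (∀ x : M, r₀ ≤ f x → α * u x ^ 2 - β ≤ g.dalembertian u x - g.innerDual x (mvfderiv (𝓡 n) f x).toLinearMap (mvfderiv (𝓡 n) u x).toLinearMap)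 → ∃ C : ℝ, ∀ x : M, u x ≤ C := by
  intro n M _ _ _ _ _ _ _ g _ f u hg α β r₀ hα hK hf hu hsol hnorm hR0 hdrift
  exact Shrinker.bounded_of_drift_laplacian_ge_sq g hg hα hK hf hu hsol hnorm hR0 hdrift

end Summit.SmoothPoincare4.SmoothPoincare4.Theorems.NoncompactShrinkerGapMW

end
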